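import Literature.IUT.HodgeArakelov.TemperedThetaMonoidsProofs
import Literature.IUT.HodgeArakelov.GaloisPairRigidity

/-!
# [IUTchII] §3, Prop 3.3 (i)(ii) and Prop 3.4 (ii) — fourth proof companion of `TemperedThetaMonoids.lean`:
# the Kummer isomorphisms `Ψ_{†F^Θ_v,α} ⥲ Ψ^ι_env(M^Θ_*)`, `∞Ψ_{†F^Θ_v,α} ⥲ ∞Ψ^ι_env(M^Θ_*)`, `Ψ_{†C_v} ⥲ Ψ_cns(M^Θ_*)`
# as RESTRICTIONS of one Kummer map, and the checkable content of the uniradiality of constant monoids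

S. Mochizuki, *Inter-universal Teichmüller theory II*, §3 "Tempered Gaussian Frobenioids" (kurims
Dec-2020 manuscript), Proposition 3.3 (i)(ii) pp. 89–90 and Proposition 3.4 (ii) pp. 92–93
[cite: Mochizuki2012, Prop 3.3 p.89]. Claim key DISPUTED (D-0012). PROOF-ONLY companion (abc-iut cell,
D-0068 sub-DAG W6-S6 of [IUTchII] Prop 3.1/3.3/3.4, seat abc-iut-w5-d169; junction rows **J8** and **J14** of
`plan/L6/SUBDAG-IUTchII-Prop-31-33-34.md`; DAG nodes **IUTchII:Prop3.3(i)**, **IUTchII:Prop3.3(ii)**,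
**IUTchII:Prop3.4(ii)**). No definition, no new named fact; nothing here asserts a disputed claim or takes a
side on [IUTchIII] Cor. 3.12 — every theorem is elementary algebra over the objects TYPED by abc-iut-L6-t2
(`TemperedThetaMonoids.lean` p404874) and abc-iut-L6-t1 (`AbsTopInterfaces.lean`, `GaloisPairRigidity.lean`).

**Prop 3.3 as printed (p. 90).** "(i) By forming Kummer classes relative to the Frobenioid structure of `†F_v`
… one obtains, for a suitable bijection of `l·ℤ`-torsors between [`Gal(Ÿ_v/Y_v)`-orbits of] “`ι`” … and images
of “`α`” via the natural surjection `Π_v ↠ l·ℤ`, collections of isomorphisms of monoids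
`Ψ_{†F^Θ_v,α} ⥲ Ψ^ι_env(M^Θ_*)`; `∞Ψ_{†F^Θ_v,α} ⥲ ∞Ψ^ι_env(M^Θ_*)` — each of which is well-defined up to composition
with an inner automorphism … and compatible with both the respective conjugation actions by `Π_X(M^Θ_*)` and
the splittings up to torsion …. (ii) By forming Kummer classes … one obtains an isomorphism of monoids
`Ψ_{†C_v} ⥲ Ψ_cns(M^Θ_*)` … compatible with the respective conjugation actions by `Π_X(M^Θ_*)`."  Printed proof:
"follow immediately from the definitions and the references quoted".

The statement file records these isomorphisms as the DATA `TemperedThetaMonoids.Prop33KummerStatements E F`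
(fields `label`, `kummerTheta`, `kummerInftyTheta`, `kummer_compatible`, `kummerConstant`, and a `Prop`-valued
slot `equivariance`), consumed downstream as a hypothesis datum (Cor. 3.5/3.6 chain).  What is PROVED here
(junction **J8**): such a datum EXISTS, with every isomorphism equal on elements to ONE monoid homomorphism
`k : O^×(T^÷_{A^Θ_∞}) →* lim_J H¹(Π_Ÿ(M^Θ_*)|_J, Π_μ(M^Θ_*))` ("forming Kummer classes"), as soon as `k` is injective
(Kummer theory), carries the unit group `O^×_{C^Θ_v}(A^Θ_∞)` onto `M^×_TM(M^Θ_*)`, the base monoid `Ψ_{†C_v}` onto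
`Ψ_cns(M^Θ_*) = M_TM(M^Θ_*)`, each conjugate `Θ^α_v` into the subset `θ^{ι(α)}_env`, with `θ^{ι(α)}_env ⊆ M^×_TM·(kΘ^α_v)^ℕ`
(the `μ_{2l}·M^×_TM`-torsor structure of the theta classes, Prop. 1.4 / Cor. 2.8 (i)), and similarly for the
`ℚ≥0`-powers (`∞θ^{ι(α)}_env ⊆ M^×_TM·k(Θ^{α,ℚ≥0}_v)` and `k(Θ^{α,ℚ≥0}_v) ⊆ ∞Ψ^{ι(α)}_env`).  The `equivariance` slot of
the datum produced is instantiated by the GENUINE statement "`k` is `Π_X(M^Θ_*)`-equivariant"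
(`equivariance_iff`), so that "compatible with the respective conjugation actions" becomes checkable; the
"well-defined up to composition with an inner automorphism" clause is the freedom in the choice of `k`
(conjugating `k` by `Π_X` gives another such map) and is not asserted.  The existence of `k` itself
([FrdII] Def. 2.1 (ii) / Thm. 2.4, [EtTh] §5, Prop. 1.3 (i): junction J6) is the INPUT, owned upstream
(abc-iut-L1-t4 `Frobenioids.Kummer.kummerClass`, abc-iut-L2-t4/t12, the model map of
`AbsoluteAnabelian/MonoidKummerEquivariantModel.lean`).

**Prop 3.4 (ii) as printed (pp. 92–93).** "the functorial algorithm `Π_v ↦ Ψ_cns(M^Θ_*(Π_v))` … depends on the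
cyclotomic rigidity isomorphism of Corollary 1.11, (b) …, hence fails to be compatible … with automorphisms of
[…] the pair `G_v(M^Θ_*(†F_v)) ↷ (Ψ_{†C_v})^{×μ}` which arise from automorphisms of […] the pair
`G_v(M^Θ_*(†F_v)) ↷ (Ψ_{†C_v})^×` [cf. Remarks 1.11.1, (i), (b); 1.8.1] — in the sense that this algorithm, as given, only
admits a uniradial formulation".  CHECKABLE CONTENT (junction **J14**, over abc-iut-L6-t1's [AbsTopIII]-interface
`AbsTopMonoids` of Example 1.8 and `PairAut` of Remark 1.11.1 (i)): FROM the two named facts of Remark 1.11.1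
(i) consumed BY NAME as hypotheses — `Rmk1111_a` ((a): `Aut(G ↷ O^⊳(G)) → Aut(G)` is bijective, [AbsTopIII]
Prop. 3.2 (iv)) and `Rmk1111_b` ((b): `Aut(G ↷ O^×(G)) ↠ Aut(G)` with kernel the `Ẑ^×`-action) — and ONE
non-triviality input (some `u ∈ Ẑ^×` acts non-trivially on `O^{×μ}(G)` through `Ism(G)`), there is an
automorphism `ψ` of `O^{×μ}(G)` commuting with the `G`-action (an automorphism of the coric pair
`G ↷ O^{×μ}(G)` over `1 ∈ Aut(G)`), INDUCED by an automorphism of the pair `G ↷ O^×(G)` over `1`, and induced by NO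
automorphism of the TM-pair `G ↷ O^⊳(G)` over `1` — `prop34ii_uniradialContent_of_rmk1111`.  This is the precise
sense in which an algorithm whose output is pinned to `O^⊳` (the constant monoid with its Kummer/valuation
rigidity, Cor. 1.11 (b)) "fails to be compatible" with the `Ẑ^×`/`Ism`-indeterminacy of the `×μ`-coric data.
CONDITIONAL on the two FACT-LIST rows by design (they are [AbsTopIII] Prop. 3.2 (iv) / 3.3 (ii) inputs,
admissible by name; nothing is added).
-/

namespace Literature.IUT.HodgeArakelov

namespace TemperedThetaMonoids

universe u v

/-! ### 1. Prop 3.3 (i)(ii): the Kummer isomorphisms as restrictions of one Kummer map (junction J8) -/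

section KummerIso

variable {P : Type u} [Group P] (E : ThetaEnvData.{u, v} P) (F : TemperedFrobenioidThetaData.{u, v} P)
variable (k : F.K →* E.H)

/-- The image of the split theta monoid `Ψ_{†F^Θ_v,α} = O^×_{C^Θ_v}·(Θ^α_v)^ℕ` under a homomorphism `k` carrying
`O^×_{C^Θ_v}(A^Θ_∞)` onto `M^×_TM` is `M^×_TM·(kΘ^α_v)^ℕ`; if moreover `kΘ^α_v ∈ θ^ι_env` and `θ^ι_env ⊆ M^×_TM·(kΘ^α_v)^ℕ`
(the theta classes form a single `M^×_TM`-torsion-orbit), this is the theta monoid `Ψ^ι_env(M^Θ_*) =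
M^×_TM·θ^{ι ℕ}_env` ([IUTchII] Prop. 3.3 (i) p. 90 "isomorphisms of monoids `Ψ_{†F^Θ_v,α} ⥲ Ψ^ι_env(M^Θ_*)`", at the
level of images). [cite: Mochizuki2012, Prop 3.3 (i) p.90] -/
theorem map_frobThetaMonoid_eq_thetaMonoid (hU : F.units.toSubmonoid.map k = E.units.toSubmonoid)
    (α : P) (ι : E.Iota) (hθ : k (F.conj α F.theta) ∈ E.thetaEnv ι)
    (hθ' : E.thetaEnv ι ⊆ (splitMonoid E.units (Submonoid.powers (k (F.conj α F.theta))) : Set E.H)) :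
    (F.frobThetaMonoid α).map k = E.thetaMonoid ι := by
  unfold TemperedFrobenioidThetaData.frobThetaMonoid ThetaEnvData.thetaMonoid splitMonoid
  rw [Submonoid.map_sup, hU, Submonoid.map_powers]
  apply le_antisymm
  · exact sup_le le_sup_left
      ((Submonoid.powers_le.mpr (Submonoid.subset_closure hθ)).trans le_sup_right)
  · exact sup_le le_sup_left (Submonoid.closure_le.mpr hθ')

/-- The same for the `ℚ≥0`-versions: if `∞θ^ι_env ⊆ M^×_TM·k(Θ^{α,ℚ≥0}_v)` and `k(Θ^{α,ℚ≥0}_v) ⊆ ∞Ψ^ι_env`, then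
`k(∞Ψ_{†F^Θ_v,α}) = ∞Ψ^ι_env(M^Θ_*)` ([IUTchII] Prop. 3.3 (i) p. 90 "`∞Ψ_{†F^Θ_v,α} ⥲ ∞Ψ^ι_env(M^Θ_*)`", at the level of
images). [cite: Mochizuki2012, Prop 3.3 (i) p.90] -/
theorem map_inftyFrobThetaMonoid_eq_inftyThetaMonoid (hU : F.units.toSubmonoid.map k = E.units.toSubmonoid)
    (α : P) (ι : E.Iota)
    (hinf : E.inftyThetaEnv ι ⊆
      (splitMonoid E.units ((rootPowers (F.conj α F.theta)).map k) : Set E.H))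
    (hinf' : ((rootPowers (F.conj α F.theta)).map k : Set E.H) ⊆ E.inftyThetaMonoid ι) :
    (F.inftyFrobThetaMonoid α).map k = E.inftyThetaMonoid ι := by
  have hinf'' : (rootPowers (F.conj α F.theta)).map k ≤ E.inftyThetaMonoid ι := fun x hx => hinf' hx
  unfold TemperedFrobenioidThetaData.inftyFrobThetaMonoid ThetaEnvData.inftyThetaMonoid splitMonoid at *
  rw [Submonoid.map_sup, hU]
  apply le_antisymm
  · exact sup_le le_sup_left hinf''
  · exact sup_le le_sup_left (Submonoid.closure_le.mpr hinf)

/-- **IUTchII:Prop3.3(i)(ii)** (kurims p. 90), junction J8 of the W6-S6 sub-DAG: the Kummer-isomorphism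
DATUM `Prop33KummerStatements E F` of the statement file EXISTS and is INDUCED by a single injective
homomorphism `k : O^×(T^÷_{A^Θ_∞}) →* lim_J H¹(Π_Ÿ(M^Θ_*)|_J, Π_μ(M^Θ_*))` ("by forming Kummer classes relative to the
Frobenioid structure of `†F_v`"): given the label assignment `α ↦ ι(α)` ("a suitable bijection of `l·ℤ`-torsors",
here any function), `k` injective with `k(O^×_{C^Θ_v}) = M^×_TM`, `k(Ψ_{†C_v}) = Ψ_cns(M^Θ_*)`, and the generator-level
containments of the two previous lemmas for every `α`, there is `K` with `K.label = ι`, every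
`K.kummerTheta α`, `K.kummerInftyTheta α`, `K.kummerConstant` equal to `k` on elements, and whose `equivariance`
slot IS the statement "`k` intertwines the conjugation actions of `Π_X(M^Θ_*)`" ("compatible with the respective
conjugation actions"). [cite: Mochizuki2012, Prop 3.3 p.90] -/
theorem exists_prop33KummerStatements_of_kummer (hk : Function.Injective k)
    (hU : F.units.toSubmonoid.map k = E.units.toSubmonoid) (hC : F.baseMonoid.map k = E.constantMonoid)
    (ι : P → E.Iota) (hθ : ∀ α : P, k (F.conj α F.theta) ∈ E.thetaEnv (ι α))
    (hθ' : ∀ α : P, E.thetaEnv (ι α) ⊆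
      (splitMonoid E.units (Submonoid.powers (k (F.conj α F.theta))) : Set E.H))
    (hinf : ∀ α : P, E.inftyThetaEnv (ι α) ⊆
      (splitMonoid E.units ((rootPowers (F.conj α F.theta)).map k) : Set E.H))
    (hinf' : ∀ α : P, ((rootPowers (F.conj α F.theta)).map k : Set E.H) ⊆ E.inftyThetaMonoid (ι α)) :
    ∃ K : Prop33KummerStatements E F,
      K.label = ι ∧
      (∀ (α : P) (x : F.frobThetaMonoid α), ((K.kummerTheta α x).1 : E.H) = k x) ∧
      (∀ (α : P) (x : F.inftyFrobThetaMonoid α), ((K.kummerInftyTheta α x).1 : E.H) = k x) ∧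
      (∀ x : F.baseMonoid, ((K.kummerConstant x).1 : E.H) = k x) ∧
      (K.equivariance ↔ ∀ (g : P) (x : F.K), k (F.conj g x) = E.conj g (k x)) := by
  refine ⟨{ label := ι
            kummerTheta := fun α =>
              ((F.frobThetaMonoid α).equivMapOfInjective k hk).trans
                (MulEquiv.submonoidCongr (map_frobThetaMonoid_eq_thetaMonoid E F k hU α (ι α) (hθ α) (hθ' α)))
            kummerInftyTheta := fun α =>
              ((F.inftyFrobThetaMonoid α).equivMapOfInjective k hk).trans
                (MulEquiv.submonoidCongr
                  (map_inftyFrobThetaMonoid_eq_inftyThetaMonoid E F k hU α (ι α) (hinf α) (hinf' α)))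
            kummer_compatible := fun α x => rfl
            kummerConstant :=
              (F.baseMonoid.equivMapOfInjective k hk).trans (MulEquiv.submonoidCongr hC)
            equivariance := ∀ (g : P) (x : F.K), k (F.conj g x) = E.conj g (k x) }, rfl, ?_, ?_, ?_, Iff.rfl⟩
  · intro α x; rfl
  · intro α x; rfl
  · intro x; rfl

/-- Under the equivariance of `k`, the isomorphisms of the datum are compatible with the conjugation actions
in the concrete sense `K.kummerTheta (βα)⁻¹ ∘ conj β = conj β ∘ K.kummerTheta α` on elements — here in the
form that matters downstream: `k` carries `β · Ψ_{†F^Θ_v,α} = Ψ_{†F^Θ_v,βα}` (statement file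
`frobThetaMonoid_conj`) onto `conj β (Ψ^{ι(α)}_env) = Ψ^{ι(βα)}_env` ([IUTchII] Prop. 3.3 (i) p. 90 "compatible with …
the respective conjugation actions by `Π_X(M^Θ_*)`"). [cite: Mochizuki2012, Prop 3.3 (i) p.90] -/
theorem thetaMonoid_map_conj_of_kummer (hU : F.units.toSubmonoid.map k = E.units.toSubmonoid)
    (hUst : ∀ (g : P) (x : F.K), x ∈ F.units → F.conj g x ∈ F.units)
    (hequiv : ∀ (g : P) (x : F.K), k (F.conj g x) = E.conj g (k x))
    (ι : P → E.Iota) (hθ : ∀ α : P, k (F.conj α F.theta) ∈ E.thetaEnv (ι α))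
    (hθ' : ∀ α : P, E.thetaEnv (ι α) ⊆
      (splitMonoid E.units (Submonoid.powers (k (F.conj α F.theta))) : Set E.H))
    (β α : P) :
    (E.thetaMonoid (ι α)).map (E.conj β).toMonoidHom = E.thetaMonoid (ι (β * α)) := by
  rw [← map_frobThetaMonoid_eq_thetaMonoid E F k hU α (ι α) (hθ α) (hθ' α),
    ← map_frobThetaMonoid_eq_thetaMonoid E F k hU (β * α) (ι (β * α)) (hθ (β * α)) (hθ' (β * α)),
    ← F.frobThetaMonoid_conj hUst β α, Submonoid.map_map, Submonoid.map_map]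
  congr 1
  ext x
  simp [hequiv]

end KummerIso

/-! ### 2. Prop 3.4 (ii): the checkable content of "uniradiality of constant monoids" (junction J14) -/

section Uniradial

open CategoryTheory

variable {S : ThetaSetting.{u}} (A : AbsTopMonoids S)

/-- **IUTchII:Prop3.4(ii)** (kurims pp. 92–93), junction J14 of the W6-S6 sub-DAG — the CHECKABLE CONTENT of
"fails to be compatible … with automorphisms of the pair `G_v ↷ (Ψ_{†C_v})^{×μ}` which arise from automorphisms of
the pair `G_v ↷ (Ψ_{†C_v})^×` [cf. Remarks 1.11.1, (i), (b); 1.8.1]", over abc-iut-L6-t1's interface `AbsTopMonoids`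
(Example 1.8: `O^⊳(G)`, `O^×(G)`, `O^{×μ}(G)`, `Ism(G)`, `Ẑ^× → Ism(G)`) and `PairAut` (Remark 1.11.1 (i)), FROM the
named facts `Rmk1111_a` ((a): forgetting `O^⊳` is a bijection `Aut(G ↷ O^⊳(G)) ⥲ Aut(G)`) and `Rmk1111_b` ((b):
forgetting `O^×` is surjective with kernel the `Ẑ^×`-action `zhatPow`), the compatibility of `zhatPow` with
`Ẑ^× → Ism(G) ↷ O^{×μ}(G)`, and ONE `u ∈ Ẑ^×` acting non-trivially on `O^{×μ}(G)`: there is an automorphism `ψ` of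
`O^{×μ}(G)` commuting with the `G`-action which IS induced by an automorphism of the pair `G ↷ O^×(G)` lying over
`1 ∈ Aut(G)` and is induced by NO automorphism of the TM-pair `G ↷ O^⊳(G)` lying over `1 ∈ Aut(G)` (the only such
being the identity, by (a)).  CONDITIONAL on the two named facts by design (FACT-LIST rows, consumed by name).
[cite: Mochizuki2012, Prop 3.4 (ii) p.92] -/
theorem prop34ii_uniradialContent_of_rmk1111
    (zhatPow : ∀ G : IsoClass S.Gk, ZHatUnits →* MulAut (A.Ounits G))
    (ha : Rmk1111_a A) (hb : Rmk1111_b A zhatPow) (G : IsoClass S.Gk)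
    (hcompat : ∀ (u : ZHatUnits) (x : A.Ounits G),
      (QuotientGroup.mk (zhatPow G u x) : A.Oxmu G) = A.actIsm G (A.toIsm G u) (QuotientGroup.mk x))
    (u : ZHatUnits) (hu : A.actIsm G (A.toIsm G u) ≠ 1) :
    ∃ ψ : MulAut (A.Oxmu G),
      (∀ (g : G.G) (x : A.Oxmu G), ψ (A.actOxmu G g x) = A.actOxmu G g (ψ x)) ∧
      (∃ p : PairAut G (A.Ounits G) (A.actOunits G), PairAut.forget p = 1 ∧
          ∀ x : A.Ounits G, (QuotientGroup.mk (p.1.2 x) : A.Oxmu G) = ψ (QuotientGroup.mk x)) ∧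
      ∀ q : PairAut G (A.Otri G) (A.actOtri G), PairAut.forget q = 1 →
          ∃ x : A.Ounits G,
            (QuotientGroup.mk (Units.map q.1.2.toMonoidHom x) : A.Oxmu G) ≠ ψ (QuotientGroup.mk x) := by
  obtain ⟨_, _, hpair⟩ := hb G
  refine ⟨A.actIsm G (A.toIsm G u), ?_, ?_, ?_⟩
  · -- `ψ` commutes with the `G`-action: `zhatPow G u` is `G`-linear on `O^×(G)` ((b), third clause)
    intro g x
    obtain ⟨y, rfl⟩ := QuotientGroup.mk_surjective x
    have hlin : zhatPow G u (A.actOunits G g y) = A.actOunits G g (zhatPow G u y) := hpair u g y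
    change A.actIsm G (A.toIsm G u) (A.actOxmu G g (QuotientGroup.mk y)) =
      A.actOxmu G g (A.actIsm G (A.toIsm G u) (QuotientGroup.mk y))
    rw [AbsTopMonoids.actOxmu, QuotientGroup.map_mk, ← hcompat, ← hcompat, QuotientGroup.map_mk]
    exact congrArg _ hlin
  · -- `ψ` is induced by the pair-automorphism `(1, zhatPow G u)` of `G ↷ O^×(G)`
    exact ⟨⟨((1 : Aut G), zhatPow G u), hpair u⟩, rfl, fun x => hcompat u x⟩
  · -- but by no automorphism of the TM-pair `G ↷ O^⊳(G)` over `1`: by (a) such a `q` is the identity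
    intro q hq
    have hq1 : q = 1 := (ha G).1 (by rw [hq]; rfl)
    have hq2 : q.1.2 = 1 := by rw [hq1]; rfl
    obtain ⟨y, hy⟩ : ∃ y : A.Oxmu G, A.actIsm G (A.toIsm G u) y ≠ y := by
      by_contra h
      exact hu (MulEquiv.ext fun y => of_not_not (not_exists.mp h y))
    obtain ⟨x, rfl⟩ := QuotientGroup.mk_surjective y
    refine ⟨x, ?_⟩
    have hid : Units.map q.1.2.toMonoidHom x = x := Units.ext (by simp [Units.coe_map, hq2])
    rw [hid]
    exact fun h => hy h.symm

end Uniradial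

end TemperedThetaMonoids

end Literature.IUT.HodgeArakelov
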